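import Literature.NumberTheory.Transcendental.RoySmallValueEstimatesAlgPointProofs
import Literature.NumberTheory.Transcendental.RoySmallValueEstimatesClosestPointProofs
import Literature.NumberTheory.Transcendental.RoySmallValueAnalytic
import HarnessLib

/-!
# Small value estimates at rational translates (Nguyen–Roy 2016) — proofs, XXVI: Proposition 10 for points of `ℙ²(ℂ)` (the closest `γᵢ`)

Twenty-sixth proofs file towards `Literature.NumberTheory.Transcendental.nguyenRoy2016_thm_1` (Nguyen–Roy,
IJNT 12 (2016) = arXiv:1412.5163). Everything here is PROVED; no named facts. The step of the proof of
**Corollary 16** that uses **Proposition 10**: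

> "Moreover, let `𝒮 = {γ₀, …, γ_{T−1}}`. If `D` is large enough, we have `T ≤ D^σ ≤ binom(D+1, 2)`,
> and Proposition 10 gives `log dist(α, 𝒮) ≤ T^{3/2} log(c₃) + log |I_D^{(T)}|_α`."

in the vocabulary of the instantiation (points `PPt` of `ℙ²(ℂ)`, the projective distance `pdist`,
the points `gamP ξ η r s i = (1 : ξ + ir : ηsⁱ)`): the tree's Proposition 10
(`NguyenRoy.exists_projDist_le_of_small_on_ideal`, stated for a representative of sup-norm `1`)
rescaled to an arbitrary representative.

* `c10 ξ η r s L` — the constant of Proposition 10 (as printed by the tree), `gvec_natCast`;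
* **`exists_pdist_gamP_le`** — if every form of degree `D` vanishing at `γ₀, …, γ_{T−1}` satisfies
  `|P(v)| ≤ 𝓛(P) ‖v‖^D ε` at a representative `v` of `a`, and `T ≤ binom(L+2, 2)`, `L < D`,
  `|s| > 1`, then `dist(a, γᵢ) ≤ c₁₀(L) ε` for some `0 ≤ i < T`.

## References

* [NguyenRoy2016] N. A. V. Nguyen, D. Roy, IJNT 12 (2016) 1273–1293 = arXiv:1412.5163,
  Proposition 10 and the proof of Corollary 16.
-/

noncomputable section

open MvPolynomial
open Literature.NumberTheory.Transcendental.Nesterenko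
open Literature.NumberTheory.Transcendental.Roy2013 (CX)

namespace Literature.NumberTheory.Transcendental

namespace NguyenRoy

section closest

variable (ξ η r s : ℂ)

/-- The constant of Proposition 10 at interpolation level `L` (as printed by the tree's
`exists_projDist_le_of_small_on_ideal`). [cite: NguyenRoy2016, Proposition 10] -/
def c10 (L : ℕ) : ℝ :=
  2 * ((L + 1) * (L + 2) / 2 : ℕ) *
    (16 * (max 1 ‖η‖⁻¹ * (1 + ‖ξ‖) * max 1 ‖r‖⁻¹) * ‖s‖ * (min 1 (‖s‖ - 1))⁻¹ ^ 2) ^ ((L + 1) ^ 3) *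
    (1 + ‖ξ‖ + ((L + 1) * (L + 2) / 2 : ℕ) * ‖r‖ + ‖η‖ * ‖s‖ ^ ((L + 1) * (L + 2) / 2)) ^ L

/-- `γ̲ᵢ` for `i ∈ ℕ`. [folklore] -/
theorem gvec_natCast (i : ℕ) : gvec ξ η r s (i : ℤ) = ![1, ξ + i * r, η * s ^ i] := by
  simp [gvec, zpow_natCast]

variable {ξ η r s}

/-- **Proposition 10 for a point of `ℙ²(ℂ)`.** If every form `P` of degree `D` vanishing at
`γ₀, …, γ_{T−1}` satisfies `|P(v)| ≤ 𝓛(P) ‖v‖^D ε` at a representative `v` of the point `a`, with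
`1 ≤ T ≤ binom(L+2, 2)`, `L < D` and `|s| > 1`, then `dist(a, γᵢ) ≤ c₁₀(L) ε` for some `0 ≤ i < T`.
[cite: NguyenRoy2016, Proposition 10; proof of Corollary 16] -/
theorem exists_pdist_gamP_le (hr : r ≠ 0) (hη : η ≠ 0) (hs : 1 < ‖s‖) {D T L : ℕ} (hT : 1 ≤ T)
    (hTM : T ≤ (L + 1) * (L + 2) / 2) (hLD : L < D) {v : V3} (hv : v ≠ 0) {ε : ℝ} (hε : 0 ≤ ε)
    (hI : ∀ P : CX, P.IsHomogeneous D → (∀ i : ℕ, i < T → eval (gvec ξ η r s i) P = 0) →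
      ‖eval v P‖ ≤ l1Norm P * ‖v‖ ^ D * ε) :
    ∃ i : ℕ, i < T ∧ pdist (Projectivization.mk ℂ v hv) (gamP ξ η r s i) ≤ c10 ξ η r s L * ε := by
  -- rescale to a representative of sup-norm `1`
  have hv0 : ‖v‖ ≠ 0 := norm_ne_zero_iff.mpr hv
  set u : V3 := ((‖v‖⁻¹ : ℝ) : ℂ) • v with hu
  have hc0 : ((‖v‖⁻¹ : ℝ) : ℂ) ≠ 0 := by exact_mod_cast inv_ne_zero hv0
  have hu1 : ‖u‖ = 1 := by
    rw [hu, norm_smul, Complex.norm_real, norm_inv, norm_norm, inv_mul_cancel₀ hv0]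
  have hI' : ∀ P : CX, P.IsHomogeneous D →
      (∀ i : ℕ, i < T → MvPolynomial.eval ![1, ξ + i * r, η * s ^ i] P = 0) →
      ‖MvPolynomial.eval u P‖ ≤ l1Norm P * ε := by
    intro P hP hvan
    have h1 := hI P hP fun i hi => by rw [gvec_natCast]; exact hvan i hi
    have h2 : eval u P = ((‖v‖⁻¹ : ℝ) : ℂ) ^ D * eval v P :=
      Roy2013.aeval_smul_of_isHomogeneous hP _ v
    rw [h2, norm_mul, norm_pow, Complex.norm_real, norm_inv, norm_norm]
    calc ‖v‖⁻¹ ^ D * ‖eval v P‖ ≤ ‖v‖⁻¹ ^ D * (l1Norm P * ‖v‖ ^ D * ε) :=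
          mul_le_mul_of_nonneg_left h1 (by positivity)
      _ = l1Norm P * ε := by
          rw [show ‖v‖⁻¹ ^ D * (l1Norm P * ‖v‖ ^ D * ε) = (‖v‖⁻¹ * ‖v‖) ^ D * (l1Norm P * ε) by ring,
            inv_mul_cancel₀ hv0, one_pow, one_mul]
  obtain ⟨i, hi, hdist⟩ := exists_projDist_le_of_small_on_ideal hr hη hs hT hTM hLD hu1 hε hI'
  refine ⟨i, hi, ?_⟩
  rw [gamP, pdist_mk, gvec_natCast, ← projDist_smul_left _ hc0]
  exact hdist

end closest

end NguyenRoy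

end Literature.NumberTheory.Transcendental

end
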